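import Literature.RepresentationTheory.HeisenbergGroup.StoneVonNeumann
import Literature.RepresentationTheory.HeisenbergGroup.DualLatticePair
import HarnessLib

/-!
# Stone–von Neumann irreducibility on `L²(X)` from ONE dual lattice pair: scalar commutant of the Schrödinger system
# of `(X, Y, β, ψ)` whenever `ψ(β x y)` admits a dual lattice pair whose scalings shrink to `0`

Topic `RepresentationTheory/HeisenbergGroup`; namespace `Literature.RepresentationTheory.HeisenbergGroup`.  KERNEL ONLY:
theorems; no definition, no named fact, no record, no `sorry`.

`StoneVonNeumann.lean` proves von Neumann's / MVW's irreducibility theorem on `L²(X, μ)`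
(`SchrodingerIrreducible.hasScalarCommutant_schrodingerSystem`) for a locally compact second countable abelian group `X`
from a DECREASING BASIS `B k` of compact open subgroups together with countably many characters separating each `B k` from
its complement, and instantiates it at `X = F_vⁿ` (balls + coordinate characters).  This file supplies those inputs from
the single structure used everywhere else in the tree's Stone–von Neumann series — a DUAL LATTICE PAIR
(`IsDualLatticePair β ψ B₁ B₂`, `DualLatticePair.lean`; [MoeglinVignerasWaldspurger1987, Chap. 2 I.3], [Weil1964, Chap. III
n° 37–39]) for the bicharacter `ψ(β x y)` of a pairing `β : X →ₗ[R] Y →ₗ[R] R`, whose unit scalings `a B₁` shrink to `0`: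

* §1 **`hasScalarCommutant_schrodingerSystem_of_isDualLatticePair`** — every bounded operator on `L²(X, μ)` commuting
  with all translations and all modulations by the characters `x ↦ ψ(β x y)`, `y ∈ Y`, is a scalar.  The basis is
  `B k = ⋂_{j ≤ k} a_j B₁` for units `a_j` with `a_j B₁` inside the `j`-th member of a countable basis of `𝓝 0`; the
  separating characters are `ψ(β · y)` for `y` in a countable dense subset of `Y` (the scaled pairs `(a_j B₁, a_j⁻¹ B₂)`
  separate, `IsDualLatticePair.smul`, and `{y ; ψ(β u y) ≠ 1} ∩ a_j⁻¹ B₂` is open);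
* §2 **`irreducible_of_hasScalarCommutant`** (abstract: a family of unitaries closed under inverses with scalar
  commutant has no closed invariant subspace other than `⊥`, `⊤`) and **`schrodingerSystem_irreducible_of_isDualLatticePair`**.

This covers at once every finite place (`B₁` = unit ball) AND the finite adèles (`B₁ = ∏_v 𝒪_vⁿ`, scalings by non-zero
integers; `DualLatticePairFiniteAdelic.lean`), i.e. the irreducibility of the `L²` Schrödinger model of `H(W_fin)` needed
for the Hilbert-space model of [GelbartRogawski1991, §3.1 p. 454 L19–21]'s `ρ_ψ`.  Nothing of the cited sources is
asserted; everything is proved from Mathlib and the tree.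

## References
* [MoeglinVignerasWaldspurger1987] C. Mœglin, M.-F. Vignéras, J.-L. Waldspurger, LNM 1291 (1987), Chap. 2 I.2 (Théorème
  (Stone, Von Neumann)), I.3.
* [Weil1964] A. Weil, Acta Math. 111 (1964), Chap. I n° 11–12, Chap. III n° 37–39.
* [GelbartRogawski1991] S. Gelbart, J. Rogawski, Invent. Math. 105 (1991), §3.1 p. 454 L19–21.
-/

set_option autoImplicit false

noncomputable section

open MeasureTheory Set Filter Topology
open scoped Pointwise InnerProductSpace

namespace Literature.RepresentationTheory.HeisenbergGroup

open SchrodingerLevi SchrodingerIrreducible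

/-! ## §2 (abstract) Scalar commutant of a self-adjoint family of unitaries ⇒ no closed invariant subspaces -/

section Abstract

variable {E : Type*} [NormedAddCommGroup E] [InnerProductSpace ℂ E] [CompleteSpace E]

/-- **scalar commutant ⇒ topological irreducibility**, for a family `𝒮` of (underlying maps of) unitaries such that the
inverse of each member is again in `𝒮`: a closed subspace invariant under `𝒮` is `⊥` or `⊤` (its orthogonal projection
commutes with `𝒮` — the members preserve `Kᗮ` too — hence is a scalar, `0` or `1`).
[cite: MoeglinVignerasWaldspurger1987, Chap. 2 I.2] -/
theorem irreducible_of_hasScalarCommutant (𝒮 : Set (E → E)) (hirr : HasScalarCommutant E 𝒮)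
    (h𝒮 : ∀ S ∈ 𝒮, ∃ U : E ≃ₗᵢ[ℂ] E, ⇑U = S ∧ (⇑U.symm : E → E) ∈ 𝒮) (K : Submodule ℂ E)
    (hKc : IsClosed (K : Set E)) (hK : ∀ S ∈ 𝒮, ∀ v ∈ K, S v ∈ K) : K = ⊥ ∨ K = ⊤ := by
  haveI : CompleteSpace K := hKc.completeSpace_coe
  -- `Kᗮ` is invariant
  have hKo : ∀ S ∈ 𝒮, ∀ w ∈ Kᗮ, S w ∈ Kᗮ := by
    intro S hS w hw
    obtain ⟨U, hU, hUs⟩ := h𝒮 S hS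
    rw [← hU]
    rw [Submodule.mem_orthogonal] at hw ⊢
    intro k hk
    rw [← U.symm.inner_map_map, U.symm_apply_apply]
    exact hw _ (hK _ hUs k hk)
  -- the projection commutes with `𝒮`
  have hP : ∀ S ∈ 𝒮, ∀ v, K.starProjection (S v) = S (K.starProjection v) := by
    intro S hS v
    obtain ⟨U, hU, -⟩ := h𝒮 S hS
    have h1 : S (K.starProjection v) ∈ K := hK S hS _ (K.starProjection_apply_mem v)
    have h2 : S (v - K.starProjection v) ∈ Kᗮ := hKo S hS _ (K.sub_starProjection_mem_orthogonal v)
    refine Submodule.eq_starProjection_of_mem_orthogonal' h1 h2 ?_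
    rw [← hU, ← map_add, add_sub_cancel]
  obtain ⟨a, ha⟩ := hirr K.starProjection hP
  rcases eq_or_ne K ⊥ with hbot | hne
  · exact Or.inl hbot
  · right
    obtain ⟨k, hkK, hk0⟩ := Submodule.exists_mem_ne_zero_of_ne_bot hne
    have ha1 : a = 1 := by
      have e1 : K.starProjection k = k := Submodule.starProjection_eq_self_iff.2 hkK
      rw [ha] at e1
      have e2 : (a - 1) • k = 0 := by rw [sub_smul, one_smul, e1, sub_self]
      rcases smul_eq_zero.1 e2 with h0 | h0
      · exact sub_eq_zero.1 h0
      · exact absurd h0 hk0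
    refine Submodule.eq_top_iff'.2 fun f => ?_
    rw [← Submodule.starProjection_eq_self_iff (K := K), ha, ha1, one_smul]

end Abstract

/-! ## §1 The Schrödinger system of a pairing with a dual lattice pair has scalar commutant -/

section LatticePair

variable {R : Type*} [CommRing R] {X Y : Type*} [AddCommGroup X] [Module R X] [AddCommGroup Y] [Module R Y]
  [TopologicalSpace X] [IsTopologicalAddGroup X] [ContinuousConstSMul R X] [LocallyCompactSpace X]
  [SecondCountableTopology X] [MeasurableSpace X] [BorelSpace X] (μ : Measure X) [μ.IsAddHaarMeasure]
  [TopologicalSpace Y] [ContinuousConstSMul R Y] [TopologicalSpace.SeparableSpace Y]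
  (β : X →ₗ[R] Y →ₗ[R] R) (ψ : AddChar R Circle) {B₁ : AddSubgroup X} {B₂ : AddSubgroup Y}
  (hβ : ∀ y : Y, Continuous fun x : X => ψ (β x y)) (hβ' : ∀ x : X, Continuous fun y : Y => ψ (β x y))

include hβ' in
/-- **Stone–von Neumann irreducibility on `L²(X)` from one dual lattice pair.**  `X` a locally compact second countable
abelian group with Haar measure `μ`, `Y` separable, `β : X →ₗ[R] Y →ₗ[R] R`, `ψ : R → S¹` with `x ↦ ψ(β x y)` and
`y ↦ ψ(β x y)` continuous, `(B₁, B₂)` a dual lattice pair for `ψ(β x y)` whose unit scalings `a B₁` shrink to `0` in `X`.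
Then every bounded operator on `L²(X, μ)` commuting with all translations and with the modulations by the characters
`x ↦ ψ(β x y)` (`y ∈ Y`; any larger multiplier family `𝓜`) is a scalar.
[cite: MoeglinVignerasWaldspurger1987, Chap. 2 I.2 Théorème (Stone, Von Neumann), I.3] -/
theorem hasScalarCommutant_schrodingerSystem_of_isDualLatticePair (hB : IsDualLatticePair β ψ B₁ B₂)
    (hX : ∀ N ∈ 𝓝 (0 : X), ∃ a : Rˣ, (((a : R) • B₁ : AddSubgroup X) : Set X) ⊆ N)
    (𝓜 : Set C(X, Circle)) (h𝓜 : Set.range (fun y : Y => (⟨fun x => ψ (β x y), hβ y⟩ : C(X, Circle))) ⊆ 𝓜) :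
    HasScalarCommutant (Lp ℂ 2 μ) (schrodingerSystem μ 𝓜) := by
  classical
  -- a countable antitone basis of `𝓝 0` and units `a k` with `a k • B₁` inside its members
  obtain ⟨u, hu⟩ := (𝓝 (0 : X)).exists_antitone_basis
  choose a ha using fun k => hX (u k) (hu.mem k)
  -- `B k = ⋂_{j ≤ k} a j • B₁`
  set B : ℕ → AddSubgroup X := fun k => ⨅ j : {j : ℕ // j ≤ k}, ((a j.1 : R) • B₁ : AddSubgroup X) with hBdef
  have hBcoe : ∀ k, (B k : Set X) = ⋂ j : {j : ℕ // j ≤ k}, (((a j.1 : R) • B₁ : AddSubgroup X) : Set X) := fun k => by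
    rw [hBdef]; simp only [AddSubgroup.coe_iInf]
  have hBle : ∀ {k j : ℕ}, j ≤ k → (B k : Set X) ⊆ (((a j : R) • B₁ : AddSubgroup X) : Set X) := fun {k j} hjk => by
    rw [hBcoe]; exact Set.iInter_subset (fun j : {j : ℕ // j ≤ k} => (((a j.1 : R) • B₁ : AddSubgroup X) : Set X)) ⟨j, hjk⟩
  have hBo : ∀ k, IsOpen (B k : Set X) := fun k => by
    haveI : Finite {j : ℕ // j ≤ k} := Set.finite_Iic k |>.to_subtype
    rw [hBcoe]; exact isOpen_iInter_of_finite fun j => (hB.smul (a j.1)).isOpen_left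
  have hBc : ∀ k, IsCompact (B k : Set X) := fun k => by
    refine (hB.smul (a 0)).isCompact_left.of_isClosed_subset ?_ (hBle (Nat.zero_le k))
    rw [hBcoe]
    exact isClosed_iInter fun j => ((a j.1 : R) • B₁ : AddSubgroup X).isClosed_of_isOpen (hB.smul (a j.1)).isOpen_left
  have hBanti : Antitone B := by
    intro k k' hkk'
    rw [hBdef]
    exact le_iInf fun j => iInf_le (fun j : {j : ℕ // j ≤ k'} => ((a j.1 : R) • B₁ : AddSubgroup X)) ⟨j.1, j.2.trans hkk'⟩
  have hBnhds : ∀ U ∈ 𝓝 (0 : X), ∃ k, (B k : Set X) ⊆ U := fun U hU => by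
    obtain ⟨k, hk⟩ := hu.mem_iff.1 hU
    exact ⟨k, (hBle le_rfl).trans ((ha k).trans hk)⟩
  -- the countable separating family: `ψ(β · y)` for `y` in a countable dense subset of `Y`
  obtain ⟨D, hDc, hDd⟩ := TopologicalSpace.exists_countable_dense Y
  set χ : Y → C(X, Circle) := fun y => ⟨fun x => ψ (β x y), hβ y⟩ with hχ
  set 𝓜₀ : Set C(X, Circle) := χ '' D with h𝓜₀
  have hcount : 𝓜₀.Countable := hDc.image χ
  have h𝓜₀𝓜 : 𝓜₀ ⊆ 𝓜 := by
    rintro _ ⟨y, -, rfl⟩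
    exact h𝓜 ⟨y, rfl⟩
  have hsep : ∀ k x, x ∉ B k → ∃ c ∈ 𝓜₀, (∀ t ∈ B k, c t = 1) ∧ c x ≠ 1 := by
    intro k x hx
    -- `x ∉ a j • B₁` for some `j ≤ k`
    obtain ⟨j, hj⟩ : ∃ j : {j : ℕ // j ≤ k}, x ∉ (((a j.1 : R) • B₁ : AddSubgroup X) : Set X) := by
      by_contra hall
      push Not at hall
      exact hx (by rw [← SetLike.mem_coe, hBcoe]; exact Set.mem_iInter.2 hall)
    -- separation by the scaled pair `(a j • B₁, (a j)⁻¹ • B₂)`, then a nearby `y ∈ D`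
    obtain ⟨y, hy, hne⟩ := (hB.smul (a j.1)).exists_right_ne_one hj
    have hO : IsOpen ({y' : Y | ψ (β x y') ≠ 1} ∩ ((((a j.1)⁻¹ : Rˣ) : R) • B₂ : AddSubgroup Y)) :=
      (isOpen_ne_fun (hβ' x) continuous_const).inter (hB.smul (a j.1)).isOpen_right
    obtain ⟨y', hy'D, hy'ne, hy'B⟩ := hDd.exists_mem_open hO ⟨y, hne, hy⟩
    refine ⟨χ y', ⟨y', hy'D, rfl⟩, fun t ht => ?_, hy'ne⟩
    exact (hB.smul (a j.1)).apply_eq_one (hBle j.2 ht) hy'B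
  exact hasScalarCommutant_schrodingerSystem μ B hBo hBc hBanti hBnhds 𝓜 𝓜₀ h𝓜₀𝓜 hcount hsep

include hβ' in
/-- **irreducibility of the Schrödinger system on `L²(X)`** under the hypotheses of
`hasScalarCommutant_schrodingerSystem_of_isDualLatticePair`, for the EXACT multiplier family `{ψ(β · y) ; y ∈ Y}`: a closed
subspace of `L²(X, μ)` invariant under all translations `τ_x` and all modulations `M_{ψ(β · y)}` is `⊥` or `⊤`
(`τ_x⁻¹ = τ_{-x}`, `M_{ψ(β · y)}⁻¹ = M_{ψ(β · (-y))}` lie in the system). "une et une seule représentation … irréductible".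
[cite: MoeglinVignerasWaldspurger1987, Chap. 2 I.2 Théorème (Stone, Von Neumann), I.3] -/
theorem schrodingerSystem_irreducible_of_isDualLatticePair (hB : IsDualLatticePair β ψ B₁ B₂)
    (hX : ∀ N ∈ 𝓝 (0 : X), ∃ a : Rˣ, (((a : R) • B₁ : AddSubgroup X) : Set X) ⊆ N)
    (K : Submodule ℂ (Lp ℂ 2 μ)) (hKc : IsClosed (K : Set (Lp ℂ 2 μ)))
    (hKτ : ∀ (x : X), ∀ f ∈ K, translate μ x f ∈ K)
    (hKM : ∀ (y : Y), ∀ f ∈ K, modulate μ (⟨fun x => ψ (β x y), hβ y⟩ : C(X, Circle)) f ∈ K) : K = ⊥ ∨ K = ⊤ := by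
  set 𝓜 : Set C(X, Circle) := Set.range (fun y : Y => (⟨fun x => ψ (β x y), hβ y⟩ : C(X, Circle))) with h𝓜
  refine irreducible_of_hasScalarCommutant (schrodingerSystem μ 𝓜)
    (hasScalarCommutant_schrodingerSystem_of_isDualLatticePair μ β ψ hβ hβ' hB hX 𝓜 subset_rfl) ?_ K hKc ?_
  · rintro S (⟨x, rfl⟩ | ⟨c, ⟨y, rfl⟩, rfl⟩)
    · refine ⟨translate μ x, rfl, Or.inl ⟨-x, ?_⟩⟩
      have h : translate μ x * translate μ (-x) = 1 := by rw [translate_mul_translate, add_neg_cancel, translate_zero]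
      have e : (translate μ x).symm = translate μ (-x) := by
        rw [← LinearIsometryEquiv.inv_def]; exact inv_eq_of_mul_eq_one_right h
      rw [e]
    · refine ⟨modulate μ ⟨fun x => ψ (β x y), hβ y⟩, rfl, Or.inr ⟨⟨fun x => ψ (β x (-y)), hβ (-y)⟩, ⟨-y, rfl⟩, ?_⟩⟩
      have hmul : (⟨fun x => ψ (β x y), hβ y⟩ : C(X, Circle)) * ⟨fun x => ψ (β x (-y)), hβ (-y)⟩ = 1 := by
        ext x
        change ((ψ (β x y) * ψ (β x (-y)) : Circle) : ℂ) = ((1 : Circle) : ℂ)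
        rw [map_neg, AddChar.map_neg_eq_inv, mul_inv_cancel]
      have h : modulate μ ⟨fun x => ψ (β x y), hβ y⟩ * modulate μ ⟨fun x => ψ (β x (-y)), hβ (-y)⟩ = 1 := by
        rw [modulate_mul_modulate, hmul, modulate_one]
      have e : (modulate μ (⟨fun x => ψ (β x y), hβ y⟩ : C(X, Circle))).symm =
          modulate μ ⟨fun x => ψ (β x (-y)), hβ (-y)⟩ := by
        rw [← LinearIsometryEquiv.inv_def]; exact inv_eq_of_mul_eq_one_right h
      rw [e]
  · rintro S (⟨x, rfl⟩ | ⟨c, ⟨y, rfl⟩, rfl⟩)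
    · exact hKτ x
    · exact hKM y

end LatticePair

end Literature.RepresentationTheory.HeisenbergGroup

end

/-! ## §3 (appendix) The same for any inverse-closed multiplier family containing the characters -/

namespace Literature.RepresentationTheory.HeisenbergGroup

open MeasureTheory Set Filter Topology SchrodingerLevi SchrodingerIrreducible
open scoped Pointwise

variable {R : Type*} [CommRing R] {X Y : Type*} [AddCommGroup X] [Module R X] [AddCommGroup Y] [Module R Y]
  [TopologicalSpace X] [IsTopologicalAddGroup X] [ContinuousConstSMul R X] [LocallyCompactSpace X]
  [SecondCountableTopology X] [MeasurableSpace X] [BorelSpace X] (μ : Measure X) [μ.IsAddHaarMeasure]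
  [TopologicalSpace Y] [ContinuousConstSMul R Y] [TopologicalSpace.SeparableSpace Y]
  (β : X →ₗ[R] Y →ₗ[R] R) (ψ : AddChar R Circle) {B₁ : AddSubgroup X} {B₂ : AddSubgroup Y}
  (hβ : ∀ y : Y, Continuous fun x : X => ψ (β x y)) (hβ' : ∀ x : X, Continuous fun y : Y => ψ (β x y))

include hβ' in
/-- **irreducibility for a larger multiplier family**: under the hypotheses of
`hasScalarCommutant_schrodingerSystem_of_isDualLatticePair`, a closed subspace of `L²(X, μ)` invariant under all
translations and under the modulations `M_c`, `c ∈ 𝓜`, for ANY family `𝓜 ⊇ {ψ(β · y)}` closed under `c ↦ c⁻¹` (e.g. all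
of `C(X, S¹)`, or the characters together with the second-degree characters of a metaplectic model) is `⊥` or `⊤`.
[cite: MoeglinVignerasWaldspurger1987, Chap. 2 I.2 Théorème (Stone, Von Neumann), I.3] -/
theorem schrodingerSystem_irreducible_of_isDualLatticePair_of_subset (hB : IsDualLatticePair β ψ B₁ B₂)
    (hX : ∀ N ∈ 𝓝 (0 : X), ∃ a : Rˣ, (((a : R) • B₁ : AddSubgroup X) : Set X) ⊆ N)
    (𝓜 : Set C(X, Circle)) (h𝓜 : Set.range (fun y : Y => (⟨fun x => ψ (β x y), hβ y⟩ : C(X, Circle))) ⊆ 𝓜)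
    (h𝓜inv : ∀ c ∈ 𝓜, c⁻¹ ∈ 𝓜)
    (K : Submodule ℂ (Lp ℂ 2 μ)) (hKc : IsClosed (K : Set (Lp ℂ 2 μ)))
    (hKτ : ∀ (x : X), ∀ f ∈ K, translate μ x f ∈ K)
    (hKM : ∀ c ∈ 𝓜, ∀ f ∈ K, modulate μ c f ∈ K) : K = ⊥ ∨ K = ⊤ := by
  refine irreducible_of_hasScalarCommutant (schrodingerSystem μ 𝓜)
    (hasScalarCommutant_schrodingerSystem_of_isDualLatticePair μ β ψ hβ hβ' hB hX 𝓜 h𝓜) ?_ K hKc ?_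
  · rintro S (⟨x, rfl⟩ | ⟨c, hc, rfl⟩)
    · refine ⟨translate μ x, rfl, Or.inl ⟨-x, ?_⟩⟩
      have h : translate μ x * translate μ (-x) = 1 := by
        rw [translate_mul_translate, add_neg_cancel, SchrodingerLevi.translate_zero]
      have e : (translate μ x).symm = translate μ (-x) := by
        rw [← LinearIsometryEquiv.inv_def]; exact inv_eq_of_mul_eq_one_right h
      rw [e]
    · refine ⟨modulate μ c, rfl, Or.inr ⟨c⁻¹, h𝓜inv c hc, ?_⟩⟩
      have h : modulate μ c * modulate μ c⁻¹ = 1 := by rw [modulate_mul_modulate, mul_inv_cancel, modulate_one]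
      have e : (modulate μ c).symm = modulate μ c⁻¹ := by
        rw [← LinearIsometryEquiv.inv_def]; exact inv_eq_of_mul_eq_one_right h
      rw [e]
  · rintro S (⟨x, rfl⟩ | ⟨c, hc, rfl⟩)
    · exact hKτ x
    · exact hKM c hc

end Literature.RepresentationTheory.HeisenbergGroup
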